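/-
Copyright (c) 2026 the pub-hodgecm-mathlib formalisation cell (harness21).  Prover seat hodgecm-mathlib-K2Liu-p11 (g0), Track B «K2-LIT»,
#184♮ = hLiu418 = `stmt-HodgeConjecture-24832`; LEAD F0P6-plan (g13) RULING «M-157k» (2): «ARCH normalisation letter = ONE S file
`K2LiuArchNormalisingScalar` → K2Liu-p11 (g0): Kudla–Rallis convention `M*_σ(s) := c_{Φ°_σ}(s)⁻¹·M_σ(s)`, `c` BY VALUE, + the ONE Γ-ratio holomorphy
check on `re s > 0`».  DEFINITIONS `archScalarCoeff`, `archNormalisingScalar`, `archIntertwiningNormalized` + their letters.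
-/
import Summits.HodgeConjecture.HodgeConjecture.Theorems.K2LiuArchIntertwiningScalarSection   -- ★ (this seat) (A∞-R): section-level `M f⁰ = c_k f⁰`
import Summits.HodgeConjecture.HodgeConjecture.Theorems.K2LiuArchIntertwiningScalarPole      -- ★ (this seat): regular part `R_k`, parity at `½`
import HarnessLib

/-!
# Crux `HLiu418`, A∞ organ: the archimedean NORMALISING SCALAR of record (letter file, M-157k (2))

Cell `hodgecm-mathlib`, crux item hLiu418 = `stmt-HodgeConjecture-24832` (helper lane `--supports`, count-neutral; definition lane).

LETTERS (consumers: Φ8 ∕ K2Liu-p10 (g2), Φ4 ∕ K2Liu-p12 (g0), (A-int-arch)∕(A∞-½) ∕ this seat):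
* `archScalarCoeff k s` — the RAW scalar `c_k(s)` of `M_w(s)` on the scalar `K_w`-type `k : ℤ`, BY VALUE
  (`(1/8)·(4π⁴·e^{−iπk}·Γ₂(s+1+k/2)⁻¹·Γ₂(s+1−k/2)⁻¹·(Γ₂(2s)·4^{−2s}))`, `Γ₂ = hermTwoGamma`); `archIntertwining_eq_archScalarCoeff_mul`:
  `M_w(s) f⁰_{s,k} = c_k(s)·f⁰_{−s,k}` on `U(2,2)` for `re s > ½` (★ (A∞-R)); `archScalarCoeff_neg : c_{−k} = c_k`.
* `archNormalisingScalar s` — the HOLOMORPHIC GERM `Q(s)` of `2·c_{±1}(s)` (the pinned Gaussian line has `|k₀| = 1`; `c_1 = c_{−1}`):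
  `Q(s) = (1/8)·(−4π⁴)·Γ₂(s+3/2)⁻¹·(π⁻¹·Γ(s+½)⁻²)·(π·Γ(2s)²·4^{−2s})`, with `two_mul_archScalarCoeff_one : 2·c_1(s) = Q(s)` (`re s > ½`;
  the simple zero of `Γ₂(s+½)⁻¹` at `½` cancels the simple pole of `Γ₂(2s)`), `differentiableOn_archNormalisingScalar` on `{0 < re s}`
  (THE ONE Γ-RATIO HOLOMORPHY CHECK), `archNormalisingScalar_half : Q(½) = −π³/8 ≠ 0`.
* `archIntertwiningNormalized s f g := 2·Q(s)⁻¹·(M_w(s) f)(g)` — the Kudla–Rallis normalised operator PINNED TO `1` ON THE GAUSSIAN LINE TYPE: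
  `archIntertwiningNormalized_archScalarSection_one ∕ _neg_one : M*_w(s) f⁰_{s,±1} = f⁰_{−s,±1}` (`re s > ½`, `Q(s) ≠ 0`), and on any scalar
  type `archIntertwiningNormalized_archScalarSection : M*_w(s) f⁰_{s,k} = (2·Q(s)⁻¹·c_k(s))·f⁰_{−s,k}`; with ★ `K2LiuArchIntertwiningScalarPole`
  (`(2s−1)c_k = R_k`, `R_k(½) = 0 ⇔ k odd`) the value∕pole of that ratio at `½` is read off per `k`.
Global use (Φ8): the scalar of the raw Eisenstein intertwiner is `(a^S/b^S)(s)·∏_σ c_{k₀}(s)·(normalised local operators)`; with `|k₀| = 1`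
the arch factor `c_{k₀} = Q/2` is HOLOMORPHIC AND NON-VANISHING at `½`, so `(s−½)·(a^S/b^S)(s)·∏_σ c_{k₀}(s)` is holomorphic near `½` iff the
finite letter is — no arch pole.  References: [Shimura1982, (1.31)], [KudlaRallis1994 (citation only)] — derived, not cited.
HONEST LABEL: HC_CM is proved only modulo the 7 printed citations (2 remaining named inputs: hLiu418 = stmt-HodgeConjecture-24832,
h413 = stmt-HodgeConjecture-24833) until rung 0 closes; count-neutral helper, closes no socket.
-/

set_option autoImplicit false
set_option linter.dupNamespace false

noncomputable section

open Complex MeasureTheory Set Matrix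
open scoped ComplexOrder

namespace Summit.HodgeConjecture.HodgeConjecture.Cruxes.HLiu418.K2LiuArchNormalisingScalar

open Summit.HodgeConjecture.HodgeConjecture.Cruxes.HLiu418.K2LiuHermTwoGammaDefs
open Summit.HodgeConjecture.HodgeConjecture.Cruxes.HLiu418.K2LiuHermTwoXiZeroValue
open Summit.HodgeConjecture.HodgeConjecture.Cruxes.HLiu418.K2LiuArchInducedTubeDefs
open Summit.HodgeConjecture.HodgeConjecture.Cruxes.HLiu418.K2LiuArchIntertwiningScalarSection
open Summit.HodgeConjecture.HodgeConjecture.Cruxes.HLiu418.K2LiuArchIntertwiningScalarPole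

/-! ## §1  The raw scalar `c_k(s)` by value -/

/-- THE RAW ARCHIMEDEAN SCALAR `c_k(s)` of the unnormalised intertwining operator `M_w(s)` of `U(2,2)` at a complex place on the scalar
`K_w`-type `k : ℤ` (closed form, meaningful as the operator's scalar for `re s > ½`; [Shimura1982, (1.31)], ★ (A∞-B)). -/
def archScalarCoeff (k : ℤ) (s : ℂ) : ℂ :=
  (1 / 8 : ℂ) * (((4 * Real.pi ^ 4 : ℝ) : ℂ) * cexp (-(Real.pi * I) * k) * (hermTwoGamma (s + 1 + k / 2))⁻¹ *
    (hermTwoGamma (s + 1 - k / 2))⁻¹ * (hermTwoGamma (2 * s) * (4 : ℂ) ^ (-(2 * s))))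

/-- Unfolding of `archScalarCoeff`. -/
theorem archScalarCoeff_def (k : ℤ) (s : ℂ) :
    archScalarCoeff k s = (1 / 8 : ℂ) * (((4 * Real.pi ^ 4 : ℝ) : ℂ) * cexp (-(Real.pi * I) * k) * (hermTwoGamma (s + 1 + k / 2))⁻¹ *
      (hermTwoGamma (s + 1 - k / 2))⁻¹ * (hermTwoGamma (2 * s) * (4 : ℂ) ^ (-(2 * s)))) := rfl

/-- **`M_w(s) f⁰_{s,k} = c_k(s) · f⁰_{−s,k}` on `U(2,2)`** (`re s > ½`; ★ (A∞-R) by name). -/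
theorem archIntertwining_eq_archScalarCoeff_mul (k : ℤ) {s : ℂ} (hs : 1 / 2 < s.re) {h : Matrix (Fin 2 ⊕ Fin 2) (Fin 2 ⊕ Fin 2) ℂ}
    (hh : hᴴ * Matrix.J (Fin 2) ℂ * h = Matrix.J (Fin 2) ℂ) :
    archIntertwining (archScalarSection k s) h = archScalarCoeff k s * archScalarSection k (-s) h :=
  archIntertwining_archScalarSection_eq k hs hh

/-- `c_{−k}(s) = c_k(s)` (`e^{iπk} = e^{−iπk}` for `k ∈ ℤ`; the two `Γ₂` factors swap). -/
theorem archScalarCoeff_neg (k : ℤ) (s : ℂ) : archScalarCoeff (-k) s = archScalarCoeff k s := by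
  have hexp : cexp (-(Real.pi * I) * ((-k : ℤ) : ℂ)) = cexp (-(Real.pi * I) * k) := by
    have h2 : cexp (-(Real.pi * I) * ((-k : ℤ) : ℂ)) = cexp (-(Real.pi * I) * k) * cexp (k * (2 * Real.pi * I)) := by
      rw [← Complex.exp_add]
      congr 1
      push_cast
      ring
    rw [h2, Complex.exp_int_mul_two_pi_mul_I, mul_one]
  rw [archScalarCoeff_def, archScalarCoeff_def, hexp]
  push_cast
  rw [show s + 1 + -(k : ℂ) / 2 = s + 1 - k / 2 by ring, show s + 1 - -(k : ℂ) / 2 = s + 1 + k / 2 by ring]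
  ring

/-- `(2s−1)·c_k(s) = R_k(s)` (★ `K2LiuArchIntertwiningScalarPole` by value). -/
theorem two_mul_sub_one_mul_archScalarCoeff (k : ℤ) {s : ℂ} (hs : 2 * s - 1 ≠ 0) :
    (2 * s - 1) * archScalarCoeff k s =
      (1 / 8 : ℂ) * (((4 * Real.pi ^ 4 : ℝ) : ℂ) * cexp (-(Real.pi * I) * k) * (hermTwoGamma (s + 1 + k / 2))⁻¹ *
        (hermTwoGamma (s + 1 - k / 2))⁻¹ * ((Real.pi : ℂ) * Complex.Gamma (2 * s) ^ 2 * (4 : ℂ) ^ (-(2 * s)))) := by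
  rw [archScalarCoeff_def, ← two_mul_sub_one_mul_hermTwoGamma hs]
  ring

/-! ## §2  The normalising scalar: the holomorphic germ of `2·c_{±1}` -/

/-- THE ARCHIMEDEAN NORMALISING SCALAR `Q(s)` (holomorphic germ of `2·c_{±1}(s)`, the pinned Gaussian line type `|k₀| = 1`):
`Q(s) = (1/8)·(−4π⁴)·Γ₂(s+3/2)⁻¹·(π⁻¹·Γ(s+½)⁻²)·(π·Γ(2s)²·4^{−2s})`.  Kudla–Rallis convention [KudlaRallis1994] (citation only). -/
def archNormalisingScalar (s : ℂ) : ℂ :=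
  (1 / 8 : ℂ) * (((-(4 * Real.pi ^ 4) : ℝ) : ℂ) * (hermTwoGamma (s + 3 / 2))⁻¹ * (((Real.pi : ℂ))⁻¹ * ((Complex.Gamma (s + 1 / 2))⁻¹) ^ 2) *
    ((Real.pi : ℂ) * Complex.Gamma (2 * s) ^ 2 * (4 : ℂ) ^ (-(2 * s))))

/-- Unfolding of `archNormalisingScalar`. -/
theorem archNormalisingScalar_def (s : ℂ) :
    archNormalisingScalar s = (1 / 8 : ℂ) * (((-(4 * Real.pi ^ 4) : ℝ) : ℂ) * (hermTwoGamma (s + 3 / 2))⁻¹ *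
      (((Real.pi : ℂ))⁻¹ * ((Complex.Gamma (s + 1 / 2))⁻¹) ^ 2) * ((Real.pi : ℂ) * Complex.Gamma (2 * s) ^ 2 * (4 : ℂ) ^ (-(2 * s)))) := rfl

/-- `Γ₂(s+½)⁻¹ = π⁻¹·(s−½)·Γ(s+½)⁻²` for `s ≠ ½` (the simple zero at `½`). [folklore] -/
theorem inv_hermTwoGamma_add_half {s : ℂ} (hs : s - 1 / 2 ≠ 0) :
    (hermTwoGamma (s + 1 / 2))⁻¹ = ((Real.pi : ℂ))⁻¹ * (s - 1 / 2) * ((Complex.Gamma (s + 1 / 2))⁻¹) ^ 2 := by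
  have h : Complex.Gamma (s + 1 / 2) = (s - 1 / 2) * Complex.Gamma (s - 1 / 2) := by
    rw [← Complex.Gamma_add_one _ hs]
    congr 1
    ring
  have hsub : (s + 1 / 2 - 1 : ℂ) = s - 1 / 2 := by ring
  rw [hermTwoGamma_def, hsub]
  by_cases hG' : Complex.Gamma (s + 1 / 2) = 0
  · rw [hG']
    simp
  · have hGm : Complex.Gamma (s - 1 / 2) = Complex.Gamma (s + 1 / 2) / (s - 1 / 2) := by
      rw [h, mul_div_cancel_left₀ _ hs]
    rw [hGm]
    have hπ : (Real.pi : ℂ) ≠ 0 := by exact_mod_cast Real.pi_ne_zero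
    field_simp

/-- **`2·c_1(s) = Q(s)`** on `re s > ½`. -/
theorem two_mul_archScalarCoeff_one {s : ℂ} (hs : 1 / 2 < s.re) : 2 * archScalarCoeff 1 s = archNormalisingScalar s := by
  have hs1 : 2 * s - 1 ≠ 0 := by
    intro h
    have h' := congrArg Complex.re h
    simp only [sub_re, mul_re, re_ofNat, im_ofNat, zero_mul, sub_zero, one_re, zero_re] at h'
    linarith
  have hs2 : s - 1 / 2 ≠ 0 := by
    intro h
    apply hs1
    linear_combination 2 * h
  have hexp : cexp (-(Real.pi * I) * (1 : ℂ)) = -1 := by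
    rw [mul_one, Complex.exp_neg, Complex.exp_pi_mul_I]
    norm_num
  have hkey := two_mul_sub_one_mul_archScalarCoeff 1 hs1
  rw [Int.cast_one, hexp, show (s + 1 - 1 / 2 : ℂ) = s + 1 / 2 by ring, show (s + 1 + 1 / 2 : ℂ) = s + 3 / 2 by ring,
    inv_hermTwoGamma_add_half hs2] at hkey
  apply mul_left_cancel₀ hs2
  rw [show (s - 1 / 2) * (2 * archScalarCoeff 1 s) = (2 * s - 1) * archScalarCoeff 1 s by ring, hkey, archNormalisingScalar_def]
  push_cast
  ring

/-- `c_{−1} = c_1`, so `2·c_{−1}(s) = Q(s)` as well. -/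
theorem two_mul_archScalarCoeff_neg_one {s : ℂ} (hs : 1 / 2 < s.re) : 2 * archScalarCoeff (-1) s = archNormalisingScalar s := by
  rw [archScalarCoeff_neg, two_mul_archScalarCoeff_one hs]

/-- **THE ONE Γ-RATIO HOLOMORPHY CHECK**: `Q` is holomorphic on `{0 < re s}` (`1/Γ₂`, `1/Γ` entire; `Γ(2s)` holomorphic there). -/
theorem differentiableOn_archNormalisingScalar : DifferentiableOn ℂ archNormalisingScalar {s : ℂ | 0 < s.re} := by
  intro s hs
  simp only [Set.mem_setOf_eq] at hs
  have hΓ : DifferentiableAt ℂ (fun s : ℂ => Complex.Gamma (2 * s)) s := by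
    have h2s : 0 < (2 * s).re := by
      simp only [mul_re, re_ofNat, im_ofNat, zero_mul, sub_zero]
      linarith
    exact (Complex.differentiableAt_Gamma _ (ne_neg_nat_of_re_pos h2s)).comp s (by fun_prop)
  have hpow : DifferentiableAt ℂ (fun s : ℂ => (4 : ℂ) ^ (-(2 * s))) s :=
    DifferentiableAt.const_cpow (by fun_prop) (Or.inl (by norm_num))
  have hα : DifferentiableAt ℂ (fun s : ℂ => (hermTwoGamma (s + 3 / 2))⁻¹) s := by
    have h := (differentiable_inv_hermTwoGamma_add (3 / 2)) s
    have he : (fun t : ℂ => (hermTwoGamma (3 / 2 + t))⁻¹) = fun t : ℂ => (hermTwoGamma (t + 3 / 2))⁻¹ := by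
      funext t
      rw [add_comm]
    rw [he] at h
    exact h
  have hG : DifferentiableAt ℂ (fun s : ℂ => (Complex.Gamma (s + 1 / 2))⁻¹) s :=
    (Complex.differentiable_one_div_Gamma.comp ((differentiable_id).add (differentiable_const _))) s
  unfold archNormalisingScalar
  exact ((differentiableAt_const _).mul ((((differentiableAt_const _).mul hα).mul ((differentiableAt_const _).mul (hG.pow 2))).mul
    (((differentiableAt_const _).mul (hΓ.pow 2)).mul hpow))).differentiableWithinAt

/-- **`Q(½) = −π³/8`** (`Γ₂(2) = π`, `Γ(1) = 1`, `4^{−1} = ¼`). -/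
theorem archNormalisingScalar_half : archNormalisingScalar (1 / 2) = -((Real.pi : ℂ) ^ 3 / 8) := by
  have hπ : (Real.pi : ℂ) ≠ 0 := by exact_mod_cast Real.pi_ne_zero
  have h32 : hermTwoGamma ((1 / 2 : ℂ) + 3 / 2) = Real.pi := by
    rw [show ((1 / 2 : ℂ) + 3 / 2) = 2 by norm_num, hermTwoGamma_def, show (2 : ℂ) - 1 = 1 by norm_num, show (2 : ℂ) = 1 + 1 by norm_num,
      Complex.Gamma_add_one 1 one_ne_zero, Complex.Gamma_one, mul_one, mul_one, mul_one]
  rw [archNormalisingScalar_def, h32, show ((1 / 2 : ℂ) + 1 / 2) = 1 by norm_num, Complex.Gamma_one,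
    show (2 * (1 / 2 : ℂ)) = 1 by norm_num, Complex.Gamma_one, Complex.cpow_neg_one]
  push_cast
  field_simp

/-- `Q(½) ≠ 0`. -/
theorem archNormalisingScalar_half_ne_zero : archNormalisingScalar (1 / 2) ≠ 0 := by
  rw [archNormalisingScalar_half]
  have hπ : (Real.pi : ℂ) ≠ 0 := by exact_mod_cast Real.pi_ne_zero
  exact neg_ne_zero.mpr (div_ne_zero (pow_ne_zero 3 hπ) (by norm_num))

/-! ## §3  The normalised operator (Kudla–Rallis convention, pinned on the Gaussian line type `|k₀| = 1`) -/

/-- THE NORMALISED ARCHIMEDEAN INTERTWINING OPERATOR `M*_w(s) f := 2·Q(s)⁻¹ · M_w(s) f` (`Q = archNormalisingScalar`), i.e.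
`c_{±1}(s)⁻¹ · M_w(s)` on `re s > ½`: normalised to `1` on the scalar `K_w`-types `k = ±1` of the pinned Gaussian line. [KudlaRallis1994] (citation only). -/
def archIntertwiningNormalized (s : ℂ) (f : Matrix (Fin 2 ⊕ Fin 2) (Fin 2 ⊕ Fin 2) ℂ → ℂ) (g : Matrix (Fin 2 ⊕ Fin 2) (Fin 2 ⊕ Fin 2) ℂ) : ℂ :=
  2 * (archNormalisingScalar s)⁻¹ * archIntertwining f g

/-- Unfolding of `archIntertwiningNormalized`. -/
theorem archIntertwiningNormalized_apply (s : ℂ) (f : Matrix (Fin 2 ⊕ Fin 2) (Fin 2 ⊕ Fin 2) ℂ → ℂ)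
    (g : Matrix (Fin 2 ⊕ Fin 2) (Fin 2 ⊕ Fin 2) ℂ) :
    archIntertwiningNormalized s f g = 2 * (archNormalisingScalar s)⁻¹ * archIntertwining f g := rfl

/-- **`M*_w(s) f⁰_{s,k} = (2·Q(s)⁻¹·c_k(s)) · f⁰_{−s,k}`** on `U(2,2)`, `re s > ½`, every scalar type `k : ℤ`. -/
theorem archIntertwiningNormalized_archScalarSection (k : ℤ) {s : ℂ} (hs : 1 / 2 < s.re) {h : Matrix (Fin 2 ⊕ Fin 2) (Fin 2 ⊕ Fin 2) ℂ}
    (hh : hᴴ * Matrix.J (Fin 2) ℂ * h = Matrix.J (Fin 2) ℂ) :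
    archIntertwiningNormalized s (archScalarSection k s) h =
      (2 * (archNormalisingScalar s)⁻¹ * archScalarCoeff k s) * archScalarSection k (-s) h := by
  rw [archIntertwiningNormalized_apply, archIntertwining_eq_archScalarCoeff_mul k hs hh]
  ring

/-- **PINNING: `M*_w(s) f⁰_{s,1} = f⁰_{−s,1}`** (`re s > ½`, `Q(s) ≠ 0`). -/
theorem archIntertwiningNormalized_archScalarSection_one {s : ℂ} (hs : 1 / 2 < s.re) (hQ : archNormalisingScalar s ≠ 0)
    {h : Matrix (Fin 2 ⊕ Fin 2) (Fin 2 ⊕ Fin 2) ℂ} (hh : hᴴ * Matrix.J (Fin 2) ℂ * h = Matrix.J (Fin 2) ℂ) :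
    archIntertwiningNormalized s (archScalarSection 1 s) h = archScalarSection 1 (-s) h := by
  rw [archIntertwiningNormalized_archScalarSection 1 hs hh, mul_assoc 2, mul_left_comm 2, two_mul_archScalarCoeff_one hs,
    inv_mul_cancel₀ hQ, one_mul]

/-- **PINNING: `M*_w(s) f⁰_{s,−1} = f⁰_{−s,−1}`** (`re s > ½`, `Q(s) ≠ 0`). -/
theorem archIntertwiningNormalized_archScalarSection_neg_one {s : ℂ} (hs : 1 / 2 < s.re) (hQ : archNormalisingScalar s ≠ 0)
    {h : Matrix (Fin 2 ⊕ Fin 2) (Fin 2 ⊕ Fin 2) ℂ} (hh : hᴴ * Matrix.J (Fin 2) ℂ * h = Matrix.J (Fin 2) ℂ) :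
    archIntertwiningNormalized s (archScalarSection (-1) s) h = archScalarSection (-1) (-s) h := by
  rw [archIntertwiningNormalized_archScalarSection (-1) hs hh, mul_assoc 2, mul_left_comm 2, two_mul_archScalarCoeff_neg_one hs,
    inv_mul_cancel₀ hQ, one_mul]

end Summit.HodgeConjecture.HodgeConjecture.Cruxes.HLiu418.K2LiuArchNormalisingScalar

end
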